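import Literature.AnabelianGeometry.Anabelioids.ComponentsOrbits

/-!
# Anabelioids: an object with transitive fibre is connected ([SGA1] V §4–5 / [SemiAnbd] §2 p. 30)

Mochizuki, *Semi-graphs of anabelioids*, Publ. RIMS **42** (2006), §2, proof of Corollary 2.7 (i)
p. 30: the open subgroup of `Π_𝒢` "determines a connected finite Galois étale covering `𝒢′ → 𝒢`" —
i.e. the object of `B(𝒢)` whose fibre is the `Π_𝒢`-set `Π_𝒢/V` is CONNECTED
[cite: MochizukiSemiAnbd2006, Cor. 2.7(i) p.30].  [SGA1, Exp. V §4–5]: for a fibre functor `F` of a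
Galois category, `X` is connected iff `Aut F` acts transitively on the (non-empty) fibre `F(X)`; Mathlib
has the forward direction (`FiberFunctor.isPretransitive_of_isConnected`); this proof-only file (cell
abc-iut, layer L3, row F-1477 / [SemiAnbd] Rmk. 2.10.1 sub-node (L1)/(A): the Galois object `A_V` of
abc-iut-L3-t12's `exists_bObj_stabilizer_eq` — "all stabilisers `V`, `[Π_𝒢 : V]` points" — is
connected, as the dictionary facts (D8)/(D1) require; seat abc-iut-L6-t18) supplies the converse:

* `isConnected_of_isPretransitive` — transitive non-empty fibre ⇒ connected (the connected component
  through a point has the whole fibre — components are orbits, `ComponentsOrbits.lean` — hence is all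
  of `X` by the mono/cardinality criterion `isIso_of_mono_of_eq_card_fiber`);
* `isPretransitive_of_stabilizer_eq_of_card` — a finite `G`-set all of whose stabilisers equal `V` and
  whose cardinality is `[G : V]` is transitive (orbit–stabiliser);
* `isConnected_of_stabilizer_eq_of_card` — hence such an object is connected.

No statement here takes a side on any disputed claim; nothing about [IUTchIII] Cor. 3.12.
-/

namespace Literature.AnabelianGeometry.Anabelioids

open CategoryTheory CategoryTheory.Limits CategoryTheory.PreGaloisCategory

universe u₁ u₂ w

/-! ### Finite `G`-sets with uniform stabiliser and the orbit–stabiliser count -/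

section GroupAction

variable {G : Type*} [Group G] {Ω : Type*} [MulAction G Ω]

/-- **Orbit–stabiliser**: if every point of the `G`-set `Ω` has stabiliser `V` and `Ω` has exactly
`[G : V]` points (a finite, non-zero number), then `G` acts transitively on `Ω` — the orbit of a point
has `[G : V]` points, hence is everything. [cite: SGA1, Exp. V §5] -/
theorem isPretransitive_of_stabilizer_eq_of_card (V : Subgroup G) [V.FiniteIndex]
    (hV : ∀ x : Ω, MulAction.stabilizer G x = V) (hcard : Nat.card Ω = V.index) :
    MulAction.IsPretransitive G Ω := by
  have hfin : Finite Ω := (Nat.card_ne_zero.mp (hcard ▸ Subgroup.FiniteIndex.index_ne_zero)).2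
  have hne : Nonempty Ω := (Nat.card_ne_zero.mp (hcard ▸ Subgroup.FiniteIndex.index_ne_zero)).1
  obtain ⟨x₀⟩ := hne
  -- the orbit of `x₀` has `[G : V] = |Ω|` points, hence is all of `Ω`
  have horb : MulAction.orbit G x₀ = Set.univ := by
    apply Set.eq_of_subset_of_ncard_le (Set.subset_univ _) ?_ Set.finite_univ
    rw [Set.ncard_univ, hcard, ← hV x₀, MulAction.index_stabilizer]
  refine ⟨fun x y => ?_⟩
  obtain ⟨a, ha⟩ := MulAction.mem_orbit_iff.mp (horb ▸ Set.mem_univ x : x ∈ MulAction.orbit G x₀)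
  obtain ⟨c, hc⟩ := MulAction.mem_orbit_iff.mp (horb ▸ Set.mem_univ y : y ∈ MulAction.orbit G x₀)
  exact ⟨c * a⁻¹, by rw [mul_smul, ← ha, inv_smul_smul, hc]⟩

end GroupAction

/-! ### Transitive fibre ⇒ connected -/

variable {C : Type u₁} [Category.{u₂} C] [GaloisCategory C] (F : C ⥤ FintypeCat.{w}) [FiberFunctor F]

/-- **An object whose fibre is non-empty and a transitive `Aut F`-set is connected** ([SGA1] V §4–5;
the converse of Mathlib's `FiberFunctor.isPretransitive_of_isConnected`): the connected component of
`X` through a point of the fibre has fibre image the whole orbit (`range_map_arrow_eq_orbit`), i.e. all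
of `F(X)`, so its inclusion is a mono with full fibre, hence an isomorphism.
[cite: SGA1, Exp. V Cor. 5.7] -/
theorem isConnected_of_isPretransitive (X : C) [hne : Nonempty (F.obj X)]
    [MulAction.IsPretransitive (Aut F) (F.obj X)] : IsConnected X := by
  obtain ⟨x₀⟩ := hne
  obtain ⟨P, hP⟩ := exists_component_mem_range F x₀
  haveI : IsConnected (P.1 : C) := P.2
  have hrange : Set.range (F.map P.1.arrow) = Set.univ := by
    rw [range_map_arrow_eq_orbit F P hP, MulAction.orbit_eq_univ]
  have hsurj : Function.Surjective (F.map P.1.arrow) := Set.range_eq_univ.mp hrange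
  have hinj : Function.Injective (F.map P.1.arrow) :=
    ConcreteCategory.injective_of_mono_of_preservesPullback (F.map P.1.arrow)
  haveI : IsIso P.1.arrow :=
    isIso_of_mono_of_eq_card_fiber F P.1.arrow (Nat.card_eq_of_bijective _ ⟨hinj, hsurj⟩)
  exact isConnected_of_iso (asIso P.1.arrow)

/-- **An object all of whose points have stabiliser `V` and whose fibre has `[Aut F : V]` points is
connected** — e.g. the object `A_V ∈ B(𝒢)` with fibre `Π_𝒢/V` attached to an open normal subgroup
`V` ("a connected finite Galois étale covering `𝒢′ → 𝒢`", [SemiAnbd] p. 30; abc-iut-L3-t12's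
`exists_bObj_stabilizer_eq` records exactly these two properties). [cite: MochizukiSemiAnbd2006, Cor. 2.7(i) p.30] -/
theorem isConnected_of_stabilizer_eq_of_card (X : C) (V : Subgroup (Aut F)) [V.FiniteIndex]
    (hV : ∀ x : F.obj X, MulAction.stabilizer (Aut F) x = V) (hcard : Nat.card (F.obj X) = V.index) :
    IsConnected X := by
  haveI : Nonempty (F.obj X) :=
    (Nat.card_ne_zero.mp (hcard ▸ Subgroup.FiniteIndex.index_ne_zero)).1
  haveI := isPretransitive_of_stabilizer_eq_of_card V hV hcard
  exact isConnected_of_isPretransitive F X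

end Literature.AnabelianGeometry.Anabelioids
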